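import Summits.MatrixMultiplication.OmegaCensus.DominoZ5Z5Sound19S5A
import Summits.MatrixMultiplication.OmegaCensus.DominoZ5Z5Sound19S0A
import Summits.MatrixMultiplication.OmegaCensus.DominoZ5Z5Sound19S0B
import HarnessLib

/-!
# Soundness of the line-certificate table for `(1,9,12)@325`, hole class `σ = 0`, part C (directions `4`, `5`)

ω-census `pub-omega`, family (b3), seat pub-omega-group gen 38.  Framing: lottery ticket; floor = certified bounds/negative ranges.
VALUE: kernel computation of the `ℤ₅²` stage of the census cell `(1,9,12)@325` of `ℤ₅ × ℤ₆₅` (design `HOME/pub-omega-group-g37/DESIGN-1-9-12.md`);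
NOT progress on ω.
`soundChk3 5 9 tree19s0 (certAt19 0)` ranges over `6 × 715` (direction, count vector) pairs, each unflagged one looked up linearly in the
`3 415`-entry certificate tables (`table19`, `exrow19`); as ONE `decide + kernel` it exceeds the kernel memory cap (probe, this seat), so it is
computed in `12` pieces (direction × half of `compsLB [] 5 9`), three files of two directions per hole class, and reassembled in part C.
Assembles **`sound19s0`** (chunking lemmas from `DominoZ5Z5Sound19S5A`).
-/

namespace Summit.MatrixMultiplication.OmegaCensus

namespace Z5Z5ThreeSet

open ZpZpDomino

set_option maxRecDepth 100000 in
set_option maxHeartbeats 4000000 in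
/-- Soundness piece: direction `4`, first half of the count vectors. [folklore] -/
theorem sound19s0_d4a : (((compsLB [] 5 9).take 358).all fun c =>
    tree19s0.mem (off 5 10 4 + polyBE 10 c) || certAt19 0 4 c) = true := by decide +kernel

set_option maxRecDepth 100000 in
set_option maxHeartbeats 4000000 in
/-- Soundness piece: direction `4`, second half of the count vectors. [folklore] -/
theorem sound19s0_d4b : (((compsLB [] 5 9).drop 358).all fun c =>
    tree19s0.mem (off 5 10 4 + polyBE 10 c) || certAt19 0 4 c) = true := by decide +kernel

set_option maxRecDepth 100000 in
set_option maxHeartbeats 4000000 in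
/-- Soundness piece: direction `5`, first half of the count vectors. [folklore] -/
theorem sound19s0_d5a : (((compsLB [] 5 9).take 358).all fun c =>
    tree19s0.mem (off 5 10 5 + polyBE 10 c) || certAt19 0 5 c) = true := by decide +kernel

set_option maxRecDepth 100000 in
set_option maxHeartbeats 4000000 in
/-- Soundness piece: direction `5`, second half of the count vectors. [folklore] -/
theorem sound19s0_d5b : (((compsLB [] 5 9).drop 358).all fun c =>
    tree19s0.mem (off 5 10 5 + polyBE 10 c) || certAt19 0 5 c) = true := by decide +kernel

/-- **Soundness check, hole class `σ = 0`**: every unflagged (direction, count vector) is certified dead at the hole value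
(`certAt19 0`) — literally the `soundChk3` hypothesis of `exists_cert_or_exc_of_coverGenE3`. [folklore] -/
theorem sound19s0 : soundChk3 5 9 tree19s0 (certAt19 0) = true := by
  refine soundChk3_of_dirs 5 9 _ _ fun j hj => ?_
  interval_cases j
  · exact all_of_take_drop _ _ 358 sound19s0_d0a sound19s0_d0b
  · exact all_of_take_drop _ _ 358 sound19s0_d1a sound19s0_d1b
  · exact all_of_take_drop _ _ 358 sound19s0_d2a sound19s0_d2b
  · exact all_of_take_drop _ _ 358 sound19s0_d3a sound19s0_d3b
  · exact all_of_take_drop _ _ 358 sound19s0_d4a sound19s0_d4b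
  · exact all_of_take_drop _ _ 358 sound19s0_d5a sound19s0_d5b

end Z5Z5ThreeSet

end Summit.MatrixMultiplication.OmegaCensus
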